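import Literature.MathematicalPhysics.QuantumFieldTheory.Balaban1983to89.B9Cor36GpCubeIsUnit

/-!
# `Balaban1983to89.B9Cor36GpCubeExtAtV` — [Balaban1985BackgroundPropagators] COROLLARY 3.6 p. 408 AT ONE COVER CUBE □: THEOREM 3.4's EXTENSION
# `G′_□(U′·1)` AT THE LOCALISED FIELD `Ṽ_□ = e^{iηχ̃_□A}·1` IS `conj b(η²G′_□(Ṽ_□))` (uniqueness of the two-sided inverse), AND THE CUBE-SIDE
# PACKAGE AT `Ṽ_□`: the base (3.42)₁₋₃ entries of `G′_□(1)` and the two transfer clauses of Sect. B at ONE rate `δ₀` — sub-row G-B9-LETTERS,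
# module M5.1b-G′ (site sector), FILE 7b-A of seat p33's plan (the input of the member-side (3.42) block `hE`)

statement-level skeleton of published theorems with citation tags; proofs where landed; nothing here is a claim about the Yang–Mills mass gap

CITATION HEADER (lean-in-tree rule).  B9 = T. Bałaban, *Propagators for lattice gauge theories in a background field*, Commun. Math. Phys. **99** (1985)
389–434 [Balaban1985BackgroundPropagators] (held `paper:balaban1985-cmp99-background-propagators`; journal page = PDF page + 388): Thm 3.4 p. 400
(«There exists a positive constant a₁ such that the operators G′(U) … extend to configurations U′U for α₁ ≦ a₁ as analytic functions of A. The extended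
operators satisfy all the inequalities of Theorems 3.1–3.3 correspondingly»; «G′(U′U) = (Δ′_a(U′U))⁻¹»); (3.64)–(3.65) p. 402 («G′(U′U) = G′(U)(I −
V′(A)G′(U))⁻¹»); Cor. 3.5 p. 407; Cor. 3.6 p. 408 l. 1–10; p. 409 l. 1–5 («The operators constructed for this sequence, which we denote by G′_□(U) …
satisfy all the inequalities of Theorems 3.1–3.3»); Thm 3.1 (3.42) p. 397; (3.60) p. 402; (3.24)–(3.25) p. 394.  [4] = [Balaban1984PropagatorsII]
(2.51)–(2.55) p. 232, Lemma 2.1 p. 234, Prop. 2.2 (2.67) p. 234.  Rows B9.Cor3.6 × B9.Thm3.4 × B9.Cor3.5 (cells only; no row head changes).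

WHY THIS FILE (cell lit-balaban, sub-row G-B9-LETTERS, module M5.1b-G′ booked to seat p33; FILE 7b «hE» of `lit-balaban-p33/RECORD-M51bGp-g96.md`, first
part; also p21's M5.2-E FILE E2-4d ask of 2026-08-28T13:09Z: «the identification `gPrimeExtEnd Gp (conj b V′ * Gp)` with `conj b (η²•GpCubeY i □ parS Ṽ|_ℝ)`
under a name»).  Sect. B's engine `B9Thm34SectBUniformR1.thm34_Gp_uniform` (applied at the cube in FILE 6 `B9Cor35GpAtCubeLetters.cor35_Gp_cube`) produces
the ABSTRACT extension `gPrimeExtEnd Gp (V′Gp)` (the operator series (3.64)) together with the two inverse laws against `Δp − V′` and two TRANSFER clauses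
(every left entry `X·Gp ≺ B_G·P·e^{−δ₀d}`, right entry `Gp·Y ≺ B_G·Lⁿη·e^{−δ₀d}` of the base letter passes to the extension at `(B, 9δ₀/10)`).  The consumers
(p21's M5.5 FILE 6 `hE` via this module's FILE 7b, p21's E2-4d) need these at the GENUINE cube letter `G′_□(Ṽ_□) = (Δ′_{a,□}(Ṽ_□))⁻¹` (r05's `GpCubeY`) and
need the base entries `Gp ≺ …`, `∇_k·Gp ≺ …`, `Gp·∇_k ≺ …` AT THE SAME `(B_G, δ₀)` as the transfer clauses (FILE 6 hides that `(δ₀, B_G)` are Theorem 3.1's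
`(δ₁, C₁)` behind its `∃`).  THIS FILE: §1 the letters `VpK` (V′ at the cube for the cut field), `GextK := gPrimeExtEnd GpK (VpK·GpK)`,
`GpVK := conj b(η²G′_□(Ṽ_□)|_ℝ)` and ★★ `GextK_eq_GpVK` (two two-sided inverses of `DpK − VpK = conj b(η⁻²Δ′_{a,□}(Ṽ_□))` coincide); §2 ★★★ `cor35_Gp_cube_shared` =
FILE 6's `cor35_Gp_cube` VERBATIM plus, in the same `∃`, the three base entries at `U = 1` and the two located thresholds behind `hST`/(2.61) at the rate
`δ₀`; §3 ★★★ `gp_cube_at_locCfg` — everything at the cut field of the (3.35) datum (FILE 4 readings, FILE 7a-prep sizes): `IsUnit Δ′_{a,□}(Ṽ_□)`,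
`GextK = GpVK`, the base entries, the (3.37)/(3.59) readings against the cube lengths, and the two transfer clauses FOR `GpVK`; ★ `hasMajorant_GpVK`
((3.42)₁ for `G′_□(Ṽ_□)` over the cube sequence's blocks: `X := 1`).

WHAT IS PROVED (3 `def`s with bodies — `VpK`, `GextK`, `GpVK` —; theorems; 0 sorry; 0 new named facts; standard axioms): `DpK_sub_VpK`, `GpVK_mul_DpK_sub_VpK`,
`DpK_sub_VpK_mul_GpVK`, ★★`GextK_eq_GpVK`, ★★★`cor35_Gp_cube_shared`, ★★★`gp_cube_at_locCfg`, ★`hasMajorant_GpVK`.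

PROOF.  Ours (bookkeeping around the printed Sect. B route); §2 is FILE 6's application of r06's engine with three more conjuncts read off FILE 5b's binders.

HONEST SCOPE / NOT CLAIMED.  As FILES 6/7a: `[NormOneClass 𝔸]` in §3; the (3.35) cube datum, the smallness `α₁ := max C (C(1+D₁θ))·Λ² ≤ min(a₁, 1/4)` (print:
«α₁ = O(1)Mα₀ sufficiently small», p. 402) and the member thresholds are displayed hypotheses; the (3.42)₂₋₄ entries of `G′_□(Ṽ_□)` with the derivatives AT
`Ṽ_□` (not at `1`) are FILE 7b-B (the `(Ṽ − 1)`-corrections), the member-side block `hE` is FILE 7b-D; nothing on `d = 4`, the continuum, reflection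
positivity or the mass gap; NOT a node discharge; no row head changes.

RELATED IN THE TREE, NOT DUPLICATED: FILE 6 `B9Cor35GpAtCubeLetters.cor35_Gp_cube` (same engine application; its proof is repeated here once because its `∃`
does not expose `(δ₀, B_G) = (δ₁, C₁)`), FILE 7a `B9Cor36GpCubeIsUnit` (the unit; its §1 identity used by name), r06 `B9Eq360Vprime.leftInverse_eq_gPrimeExt`
(inverse uniqueness in a normed ring under `‖V′G′‖ < 1` — here the finite-dimensional two-sided form suffices), r05 `B9CubeLettersOpsL0.GpCubeY`.
-/

noncomputable section

namespace Literature.MathematicalPhysics.QuantumFieldTheory.Balaban1983to89.B9Cor36GpCubeExtAtV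

open Literature.MathematicalPhysics.QuantumFieldTheory.Balaban1983to89
open Literature.MathematicalPhysics.QuantumFieldTheory.Balaban1983to89.B4PartitionUnity22 (thetaProf D1)
open Literature.MathematicalPhysics.QuantumFieldTheory.Balaban1983to89.B6RandomWalk (HasMajorant hasMajorant_mono)
open Literature.MathematicalPhysics.QuantumFieldTheory.Balaban1983to89.B9Thm34Ext (toB6)
open Literature.MathematicalPhysics.QuantumFieldTheory.Balaban1983to89.B9Eq352DivFormLetters (conj conj_sub)
open Literature.MathematicalPhysics.QuantumFieldTheory.Balaban1983to89.B9Eq352GradLetters (diffLetter)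
open Literature.MathematicalPhysics.QuantumFieldTheory.Balaban1983to89.B9Eq360Vprime (gPrimeExtEnd)
open Literature.MathematicalPhysics.QuantumFieldTheory.Balaban1983to89.B9Eq360VprimeLetters (vPrimeConc)
open Literature.MathematicalPhysics.QuantumFieldTheory.Balaban1983to89.B9Eq39Adjoint (fluct covD covDstar)
open Literature.MathematicalPhysics.QuantumFieldTheory.Balaban1983to89.B9Eq352DivForm (tauB)
open Literature.MathematicalPhysics.QuantumFieldTheory.Balaban1983to89.B9Thm34SectBUniformR1 (thm34_Gp_uniform)
open Literature.MathematicalPhysics.QuantumFieldTheory.Balaban1983to89.B6KLevelCensusIndexV1 (KIdx kGeo)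
open Literature.MathematicalPhysics.QuantumFieldTheory.Balaban1983to89.B6Cover236MultiLevelBlocks (cubes)
open Literature.MathematicalPhysics.QuantumFieldTheory.Balaban1983to89.B6GlobalChartV1 (PV boxEquiv)
open Literature.MathematicalPhysics.QuantumFieldTheory.Balaban1983to89.B9BackgroundsKLevelV1 (shiftsV1)
open Literature.MathematicalPhysics.QuantumFieldTheory.Balaban1983to89.B9Eq360DeltaPrimeAY (mulY AfldY chartA)
open Literature.MathematicalPhysics.QuantumFieldTheory.Balaban1983to89.B9Eq360DeltaPrimeACubeY (blkCubeY kQCubeY sQCubeY cCubeY kFCubeY sFCubeY levCubeY_eq)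
open Literature.MathematicalPhysics.QuantumFieldTheory.Balaban1983to89.B9CubeLettersOpsL0 (oddMh cubeFamY levCubeY deltaPrimeACubeY GpCubeY
  GpCubeY_mul_deltaPrimeACubeY deltaPrimeACubeY_mul_GpCubeY)
open Literature.MathematicalPhysics.QuantumFieldTheory.Balaban1983to89.B9CubeLettersBondOpsL0 (BlkCubeY)
open Literature.MathematicalPhysics.QuantumFieldTheory.Balaban1983to89.B9CubeGeometryInputs (geoCK geoCK_len geoCK_eta geoCK_eta_pos geoCK_L geoCK_dist
  geoCK_dist_axioms geoCK_len_pos geoCK_eta_le_len geoCK_len_blkCubeY RM1 N1 exists_h261_geoCK hST_geoCK stencil_geoCK geoCK_site_nonempty)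
open Literature.MathematicalPhysics.QuantumFieldTheory.Balaban1983to89.B9Cor35GpCubeInputsAtOne (DpK GpK wK cfunK eta_ne_zero wK_nonneg card_block_mul_wK_le
  norm_kQCubeY_one_le norm_sQCubeY_one_le abs_cfunK_le conj_one' DpK_mul_GpK h342_1_cube h342_2_cube_inl h342_3_cube_inr h342_2_cube_inr h342_3_cube_inl)
open Literature.MathematicalPhysics.QuantumFieldTheory.Balaban1983to89.B9Cor35GpAtCubeLetters (thm31_cube_allOrientations hasMajorant_geomT_of_toB6)
open Literature.MathematicalPhysics.QuantumFieldTheory.Balaban1983to89.B9Cor36CutoffField337 (cutFldY)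
open Literature.MathematicalPhysics.QuantumFieldTheory.Balaban1983to89.B9Cor36CubeCutoffs (SC NearC chiY chiTY locCfgY readings337_locFld
  scaleLen_levCubeY_bounds one_le_SC)
open Literature.MathematicalPhysics.QuantumFieldTheory.Balaban1983to89.B9Eq359CubeKernelsAtOne (Cq Cq_nonneg norm_kFCubeY_parSymY_le norm_sFCubeY_parSymY_le
  ownLevel_of_blockwise isUnit_of_conj_laws)
open Literature.MathematicalPhysics.QuantumFieldTheory.Balaban1983to89.B9Cor36GpCubeIsUnit (DpK_sub_conj_vPrimeConc)
open Literature.MathematicalPhysics.QuantumFieldTheory.Balaban1983to89.Node00 (SiteY CfgY GaugeY SiteParY toKT shiftY gaugeY parSymY parSymY_one UboxY)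

variable {d ℓ : ℕ} {hd : 1 ≤ d + 1} {hL : Odd (ℓ + 1) ∧ 1 < ℓ + 1} {b₀ b₁ : ℝ}

variable {𝔸 : Type} [NormedRing 𝔸] [NormedAlgebra ℂ 𝔸] [CompleteSpace 𝔸]
variable {ι : Type} [Fintype ι] (b : Module.Basis ι ℝ 𝔸)

/-! ## §1  The letters at the localised field and the identification `G′_□(U′·1) = conj b(η²G′_□(Ṽ_□))` -/

section Letters

variable (i : KIdx d ℓ hd hL b₀ b₁) (c : ↥(cubes (toKT i).D.toDomains)) (par : SiteParY 𝔸 i)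

/-- **`V′_□(Ã)` — the concrete (3.60) letter `V′(A)` AT THE CUBE for the cut field `Ã = χ̃_□A`**, on FILE 1's cube kernels at the base `U = 1` and the localised
field `Ṽ_□ = e^{iηÃ}·1` (`kF = kQ(Ṽ_□) − kQ(1)`, `sF = sQ(Ṽ_□) − sQ(1)`, weight `cfun = η⁻²c_□`), in real coordinates: `conj b (vPrimeConc …)`.
[cite: Balaban1985BackgroundPropagators, (3.60) p.402, (3.57)–(3.59) p.401–402, Cor. 3.6 p.408] -/
def VpK (A : AfldY 𝔸 i) : Module.End ℝ (SiteY i × ι → ℝ) :=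
  conj b (vPrimeConc (shiftY i) (fun _ _ => (1 : 𝔸ˣ)) (geoCK i c).eta (chartA i (cutFldY i (chiTY i c) A)) (blkCubeY i c)
    (kQCubeY i c par (fun _ _ => 1)) (kFCubeY i c par (fun _ _ => 1) (locCfgY i c (kGeo i).eta A)) (sQCubeY i c par (fun _ _ => 1))
    (sFCubeY i c par (fun _ _ => 1) (locCfgY i c (kGeo i).eta A)) (cfunK i c))

/-- **`G′_□(U′·1)` — THEOREM 3.4's EXTENSION AT THE CUBE LETTER** for the cut field: the operator series `G′_□(1)(I − V′_□(Ã)G′_□(1))⁻¹` of (3.64) in the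
cell's letters (`gPrimeExtEnd Gp (V′Gp)` with `Gp = conj b(η²G′_□(1))`). [cite: Balaban1985BackgroundPropagators, (3.64)–(3.65) p.402, Thm 3.4 p.400, Cor. 3.6 p.408] -/
def GextK (A : AfldY 𝔸 i) : Module.End ℝ (SiteY i × ι → ℝ) := gPrimeExtEnd (GpK b i c par) (VpK b i c par A * GpK b i c par)

/-- **`conj b(η²G′_□(Ṽ_□))` — THE GENUINE CUBE LETTER AT THE LOCALISED FIELD**, print's units, real coordinates (r05's `GpCubeY i □ par Ṽ_□ =
Ring.inverse (Δ′_{a,□}(Ṽ_□))`). [cite: Balaban1985BackgroundPropagators, p.409 l.1–5 («G′_□(U)»), (3.25) p.394, Thm 3.4 p.400 («G′(U′U) = (Δ′_a(U′U))⁻¹»)] -/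
def GpVK (A : AfldY 𝔸 i) : Module.End ℝ (SiteY i × ι → ℝ) :=
  conj b (((kGeo i).eta ^ 2) • (GpCubeY i c par (locCfgY i c (kGeo i).eta A)).restrictScalars ℝ)

/-- `Δp − V′_□(Ã) = conj b(η⁻²Δ′_{a,□}(Ṽ_□))` (FILE 7a §1 in the letters of this file). [cite: Balaban1985BackgroundPropagators, (3.60) p.402, (3.24) p.394] -/
theorem DpK_sub_VpK (A : AfldY 𝔸 i) :
    DpK b i c par - VpK b i c par A = conj b ((((kGeo i).eta ^ 2)⁻¹) • (deltaPrimeACubeY i c par (locCfgY i c (kGeo i).eta A)).restrictScalars ℝ) :=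
  DpK_sub_conj_vPrimeConc b i c par A

/-- `conj b(η²G′_□(Ṽ_□))·(Δp − V′_□) = 1` when `Δ′_{a,□}(Ṽ_□)` is a unit. [cite: Balaban1985BackgroundPropagators, (3.25) p.394, Thm 3.4 p.400] -/
theorem GpVK_mul_DpK_sub_VpK (A : AfldY 𝔸 i) (hunit : IsUnit (deltaPrimeACubeY i c par (locCfgY i c (kGeo i).eta A))) :
    GpVK b i c par A * (DpK b i c par - VpK b i c par A) = 1 := by
  have hη2 : ((kGeo i).eta ^ 2 : ℝ) ≠ 0 := pow_ne_zero 2 (eta_ne_zero i)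
  rw [DpK_sub_VpK, GpVK, ← B9Eq352DivFormLetters.conj_mul, smul_mul_smul_comm, mul_inv_cancel₀ hη2, one_smul, Module.End.mul_eq_comp,
    ← LinearMap.restrictScalars_comp, ← Module.End.mul_eq_comp, GpCubeY_mul_deltaPrimeACubeY i c par _ hunit]
  exact conj_one' b

/-- `(Δp − V′_□)·conj b(η²G′_□(Ṽ_□)) = 1` when `Δ′_{a,□}(Ṽ_□)` is a unit. [cite: Balaban1985BackgroundPropagators, (3.25) p.394, Thm 3.4 p.400] -/
theorem DpK_sub_VpK_mul_GpVK (A : AfldY 𝔸 i) (hunit : IsUnit (deltaPrimeACubeY i c par (locCfgY i c (kGeo i).eta A))) :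
    (DpK b i c par - VpK b i c par A) * GpVK b i c par A = 1 := by
  have hη2 : ((kGeo i).eta ^ 2 : ℝ) ≠ 0 := pow_ne_zero 2 (eta_ne_zero i)
  rw [DpK_sub_VpK, GpVK, ← B9Eq352DivFormLetters.conj_mul, smul_mul_smul_comm, inv_mul_cancel₀ hη2, one_smul, Module.End.mul_eq_comp,
    ← LinearMap.restrictScalars_comp, ← Module.End.mul_eq_comp, deltaPrimeACubeY_mul_GpCubeY i c par _ hunit]
  exact conj_one' b

/-- ★★ **THE IDENTIFICATION `G′_□(U′·1) = conj b(η²G′_□(Ṽ_□))`**: Theorem 3.4's extension at the cube letter, once it is a two-sided inverse of `Δp − V′_□(Ã) =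
conj b(η⁻²Δ′_{a,□}(Ṽ_□))` (Sect. B's conclusions (1)–(2)), IS the genuine cube letter at the localised field in real coordinates — two two-sided inverses of one
element coincide, and `Δ′_{a,□}(Ṽ_□)` is then a unit (`isUnit_of_conj_laws`).  Print: «G′(U′U) = (Δ′_a(U′U))⁻¹ exists».
[cite: Balaban1985BackgroundPropagators, Thm 3.4 p.400, (3.64)–(3.65) p.402, Cor. 3.6 p.408, p.409 l.1–5] -/
theorem GextK_eq_GpVK (A : AfldY 𝔸 i) (h1 : (DpK b i c par - VpK b i c par A) * GextK b i c par A = 1)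
    (h2 : GextK b i c par A * (DpK b i c par - VpK b i c par A) = 1) :
    IsUnit (deltaPrimeACubeY i c par (locCfgY i c (kGeo i).eta A)) ∧ GextK b i c par A = GpVK b i c par A := by
  have h1' := h1
  have h2' := h2
  rw [DpK_sub_VpK] at h1' h2'
  have hunit : IsUnit (deltaPrimeACubeY i c par (locCfgY i c (kGeo i).eta A)) :=
    isUnit_of_conj_laws b _ (inv_ne_zero (pow_ne_zero 2 (eta_ne_zero i))) _ h1' h2'
  refine ⟨hunit, ?_⟩
  calc GextK b i c par A = (GpVK b i c par A * (DpK b i c par - VpK b i c par A)) * GextK b i c par A := by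
        rw [GpVK_mul_DpK_sub_VpK b i c par A hunit, one_mul]
    _ = GpVK b i c par A := by rw [mul_assoc, h1, mul_one]

end Letters

/-! ## §2  FILE 6's engine application with the base entries and the located thresholds EXPOSED at the same `(δ₀, B_G)` -/

section Shared

variable [DecidableEq ι]

/-- ★★★ **COROLLARY 3.5 FOR `G′_□`, SHARED-CONSTANT FORM** — FILE 6's `cor35_Gp_cube` VERBATIM (Sect. B's engine at `U := 1`, `g := geoCK i □`, every `A`-independent
binder discharged) with, inside the same existential, (a) the two located member thresholds behind the scale transfers and (2.61) at the rate `δ₀`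
(`4·log L/((9/5000)δ₀) ≤ R·M − 1`, `N₁((9/5000)δ₀) + 1 ≤ R·L·M_h`), and (b) Theorem 3.1's base entries at `U = 1` in conj-`b` form AT THE SAME `(B_G, δ₀)`:
`Gp ≺ B_G(Lⁿη)²e^{−δ₀d}`, `conj b(∇_k)·Gp ≺ B_GLⁿηe^{−δ₀d}`, `Gp·conj b(∇_k) ≺ B_GLⁿηe^{−δ₀d}` for every `k ∈ κ ⊕ κ` — followed by the engine's four conclusions.
[cite: Balaban1985BackgroundPropagators, Cor. 3.5 p.407, Thm 3.4 p.400, Thm 3.1 (3.42) p.397, p.409 l.1–5, (3.60)–(3.65) p.402; Balaban1984PropagatorsII, Lemma 2.1 p.234, Prop. 2.2 (2.67) p.234] -/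
theorem cor35_Gp_cube_shared (d ℓ : ℕ) (hℓ : 1 ≤ ℓ) (Cq M₂ : ℝ) (hCq : 0 ≤ Cq) (hM₂ : 0 ≤ M₂) (hrepr : ∀ (v : 𝔸) (j : ι), |b.repr v j| ≤ M₂ * ‖v‖)
    (h1 : ‖(1 : 𝔸)‖ ≤ 1) :
    ∃ δ₀ BG M₀ T₀ : ℝ, ∃ N₀ : ℕ, 0 < δ₀ ∧ 0 < BG ∧ ∃ a₁ : ℝ, 0 < a₁ ∧ ∃ B : ℝ, 0 ≤ B ∧
    ∀ {hd : 1 ≤ d + 1} {hL : Odd (ℓ + 1) ∧ 1 < ℓ + 1} {b₀ b₁ : ℝ} (i : KIdx d ℓ hd hL b₀ b₁) (c : ↥(cubes (toKT i).D.toDomains)) (Rr : ℝ) (H : Prop)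
      (par : SiteParY 𝔸 i), (∀ z w, par (fun _ _ => 1) z w = 1) →
      M₀ ≤ ((ℓ : ℝ) + 1) * (toKT i).Mh → N₀ + 1 ≤ (toKT i).R * ((ℓ + 1) * (toKT i).Mh) → T₀ ≤ RM1 i →
    (4 * Real.log ((ℓ : ℝ) + 1) / (9 / 5000 * δ₀) ≤ RM1 i ∧ N1 d ℓ (9 / 5000 * δ₀) + 1 ≤ (toKT i).R * ((ℓ + 1) * (toKT i).Mh)) ∧
    HasMajorant (g := toB6 (geoCK i c) Rr H) (fun p : SiteY i × ι => blkCubeY i c p.1) (GpK b i c par)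
      (fun a a' => BG * (geoCK i c).len a ^ 2 * Real.exp (-(δ₀ * (geoCK i c).dist a a'))) ∧
    (∀ k : Fin (d + 1) ⊕ Fin (d + 1), HasMajorant (g := toB6 (geoCK i c) Rr H) (fun p : SiteY i × ι => blkCubeY i c p.1)
      (conj b (diffLetter (shiftY i) (fun _ _ => (1 : 𝔸ˣ)) ((((geoCK i c).eta : ℂ))⁻¹) k) * GpK b i c par)
      (fun a a' => BG * (geoCK i c).len a * Real.exp (-(δ₀ * (geoCK i c).dist a a')))) ∧
    (∀ k : Fin (d + 1) ⊕ Fin (d + 1), HasMajorant (g := toB6 (geoCK i c) Rr H) (fun p : SiteY i × ι => blkCubeY i c p.1)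
      (GpK b i c par * conj b (diffLetter (shiftY i) (fun _ _ => (1 : 𝔸ˣ)) ((((geoCK i c).eta : ℂ))⁻¹) k))
      (fun a a' => BG * (geoCK i c).len a * Real.exp (-(δ₀ * (geoCK i c).dist a a')))) ∧
    ∀ (α₁ : ℝ), 0 ≤ α₁ → α₁ ≤ a₁ →
    ∀ (A : Fin (d + 1) → SiteY i → 𝔸) (kF : BlkCubeY i c → SiteY i → 𝔸 →L[ℝ] 𝔸) (sF : SiteY i → 𝔸 →L[ℝ] 𝔸),
      (∀ y x, blkCubeY i c x = y → ‖kF y x‖ ≤ Cq * α₁ * wK i c y) → (∀ x, ‖sF x‖ ≤ Cq * α₁) →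
      (∀ ν k x, ‖(((geoCK i c).eta : ℂ)⁻¹) • covDstar (shiftY i) (fun _ _ => (1 : 𝔸ˣ)) ν (A k) x‖ ≤ α₁ * ((geoCK i c).len (blkCubeY i c x) ^ 2)⁻¹) →
      (∀ μ ν x, ‖(((geoCK i c).eta : ℂ)⁻¹) • covD (shiftY i) (fun _ _ => (1 : 𝔸ˣ)) μ (A ν) x‖ ≤ α₁ * ((geoCK i c).len (blkCubeY i c x) ^ 2)⁻¹) →
      (∀ μ x, ‖(((geoCK i c).eta : ℂ)⁻¹) • covDstar (shiftY i) (fun _ _ => (1 : 𝔸ˣ)) μ (tauB (shiftY i) (fun _ _ => (1 : 𝔸ˣ)) μ (A μ)) x‖ ≤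
        α₁ * ((geoCK i c).len (blkCubeY i c x) ^ 2)⁻¹) →
      (∀ k x, ‖A k x‖ ≤ α₁ * ((geoCK i c).len (blkCubeY i c x))⁻¹) →
      (∀ ν k x, ‖tauB (shiftY i) (fun _ _ => (1 : 𝔸ˣ)) ν (A k) x‖ ≤ α₁ * ((geoCK i c).len (blkCubeY i c x))⁻¹) →
      (DpK b i c par - conj b (vPrimeConc (shiftY i) (fun _ _ => (1 : 𝔸ˣ)) (geoCK i c).eta A (blkCubeY i c) (kQCubeY i c par (fun _ _ => 1)) kF
          (sQCubeY i c par (fun _ _ => 1)) sF (cfunK i c))) *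
        (gPrimeExtEnd (GpK b i c par) (conj b (vPrimeConc (shiftY i) (fun _ _ => (1 : 𝔸ˣ)) (geoCK i c).eta A (blkCubeY i c)
          (kQCubeY i c par (fun _ _ => 1)) kF (sQCubeY i c par (fun _ _ => 1)) sF (cfunK i c)) * GpK b i c par)) = 1 ∧
      (gPrimeExtEnd (GpK b i c par) (conj b (vPrimeConc (shiftY i) (fun _ _ => (1 : 𝔸ˣ)) (geoCK i c).eta A (blkCubeY i c)
          (kQCubeY i c par (fun _ _ => 1)) kF (sQCubeY i c par (fun _ _ => 1)) sF (cfunK i c)) * GpK b i c par)) *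
        (DpK b i c par - conj b (vPrimeConc (shiftY i) (fun _ _ => (1 : 𝔸ˣ)) (geoCK i c).eta A (blkCubeY i c) (kQCubeY i c par (fun _ _ => 1)) kF
          (sQCubeY i c par (fun _ _ => 1)) sF (cfunK i c))) = 1 ∧
      (∀ (X : Module.End ℝ (SiteY i × ι → ℝ)) (P : BlkCubeY i c → ℝ), (∀ y, 0 ≤ P y) →
        HasMajorant (g := toB6 (geoCK i c) Rr H) (fun p : SiteY i × ι => blkCubeY i c p.1) (X * GpK b i c par)
          (fun a a' => BG * P a * Real.exp (-(δ₀ * (geoCK i c).dist a a'))) →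
        HasMajorant (g := toB6 (geoCK i c) Rr H) (fun p : SiteY i × ι => blkCubeY i c p.1)
          (X * (gPrimeExtEnd (GpK b i c par) (conj b (vPrimeConc (shiftY i) (fun _ _ => (1 : 𝔸ˣ)) (geoCK i c).eta A (blkCubeY i c)
            (kQCubeY i c par (fun _ _ => 1)) kF (sQCubeY i c par (fun _ _ => 1)) sF (cfunK i c)) * GpK b i c par)))
          (fun a a' => B * P a * Real.exp (-(9 / 10 * δ₀ * (geoCK i c).dist a a')))) ∧
      (∀ Y : Module.End ℝ (SiteY i × ι → ℝ),
        HasMajorant (g := toB6 (geoCK i c) Rr H) (fun p : SiteY i × ι => blkCubeY i c p.1) (GpK b i c par * Y)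
          (fun a a' => BG * (geoCK i c).len a * Real.exp (-(δ₀ * (geoCK i c).dist a a'))) →
        HasMajorant (g := toB6 (geoCK i c) Rr H) (fun p : SiteY i × ι => blkCubeY i c p.1)
          ((gPrimeExtEnd (GpK b i c par) (conj b (vPrimeConc (shiftY i) (fun _ _ => (1 : 𝔸ˣ)) (geoCK i c).eta A (blkCubeY i c)
            (kQCubeY i c par (fun _ _ => 1)) kF (sQCubeY i c par (fun _ _ => 1)) sF (cfunK i c)) * GpK b i c par)) * Y)
          (fun a a' => B * (geoCK i c).len a * Real.exp (-(9 / 10 * δ₀ * (geoCK i c).dist a a')))) := by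
  classical
  -- FILE 6 §1: Theorem 3.1 for `G′_□(1)`, all orientations, one rate `δ₁`, one constant `C₁`
  obtain ⟨δ₁, C₁, M₀, T₀, N₀, hδ₁, hC₁, h31⟩ := thm31_cube_allOrientations d ℓ hℓ
  -- FILE 5a: ONE (2.61) exponent `dB` at the rate `δ₁`
  obtain ⟨dB, h261⟩ := exists_h261_geoCK d ℓ hδ₁
  -- Sect. B's engine, lattice-free constants
  have hΛf : ∀ α : ℝ, 0 < α → (1 : ℝ) ≤ ((ℓ : ℝ) + 1) ^ 4 := fun α _ =>
    one_le_pow₀ (by linarith [(Nat.cast_nonneg ℓ : (0 : ℝ) ≤ ℓ)])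
  obtain ⟨a₁, ha₁, B, hB, H34⟩ := thm34_Gp_uniform (κ := Fin (d + 1)) b dB δ₁ C₁ Cq 1 1 M₂ (fun _ => ((ℓ : ℝ) + 1) ^ 4) hC₁ hCq zero_le_one hM₂ hδ₁
    hΛf hrepr
  refine ⟨δ₁, C₁, M₀, max T₀ (4 * Real.log ((ℓ : ℝ) + 1) / (9 / 5000 * δ₁)), max N₀ (N1 d ℓ (9 / 5000 * δ₁)), hδ₁, hC₁, a₁, ha₁, B, hB, ?_⟩
  intro hd hL b₀ b₁ i c Rr H par hpar hM hN hT
  haveI : Nonempty (geoCK i c).Site := geoCK_site_nonempty i c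
  have hN₀ : N₀ + 1 ≤ (toKT i).R * ((ℓ + 1) * (toKT i).Mh) := le_trans (Nat.succ_le_succ (le_max_left _ _)) hN
  have hN1 : N1 d ℓ (9 / 5000 * δ₁) + 1 ≤ (toKT i).R * ((ℓ + 1) * (toKT i).Mh) := le_trans (Nat.succ_le_succ (le_max_right _ _)) hN
  have hT₀ : T₀ ≤ RM1 i := (le_max_left _ _).trans hT
  have hT1 : 4 * Real.log ((ℓ : ℝ) + 1) / (9 / 5000 * δ₁) ≤ RM1 i := (le_max_right _ _).trans hT
  obtain ⟨hdnn, htri, hrefl, hsym⟩ := geoCK_dist_axioms i c Rr H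
  obtain ⟨hd₀B, hd₀F, hd₀0⟩ := stencil_geoCK i c
  obtain ⟨e1, e2, e3, e2', e3'⟩ := h31 i c Rr H hM hN₀ hT₀
  -- Theorem 3.1 in conj-`b` form (FILE 5b)
  have g342_1 := h342_1_cube b i c par hpar Rr H (hasMajorant_geomT_of_toB6 i c Rr H e1)
  have g342_2 : ∀ k : Fin (d + 1) ⊕ Fin (d + 1), HasMajorant (g := toB6 (geoCK i c) Rr H) (fun p : SiteY i × ι => blkCubeY i c p.1)
      (conj b (diffLetter (shiftY i) (fun _ _ => (1 : 𝔸ˣ)) ((((geoCK i c).eta : ℂ))⁻¹) k) * GpK b i c par)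
      (fun a a' => C₁ * (geoCK i c).len a * Real.exp (-(δ₁ * (geoCK i c).dist a a'))) := by
    rintro (μ | μ)
    · exact h342_2_cube_inl b i c par hpar Rr H μ (hasMajorant_geomT_of_toB6 i c Rr H (e2 μ))
    · exact h342_2_cube_inr b i c par hpar Rr H μ (e2' μ)
  have g342_3 : ∀ k : Fin (d + 1) ⊕ Fin (d + 1), HasMajorant (g := toB6 (geoCK i c) Rr H) (fun p : SiteY i × ι => blkCubeY i c p.1)
      (GpK b i c par * conj b (diffLetter (shiftY i) (fun _ _ => (1 : 𝔸ˣ)) ((((geoCK i c).eta : ℂ))⁻¹) k))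
      (fun a a' => C₁ * (geoCK i c).len a * Real.exp (-(δ₁ * (geoCK i c).dist a a'))) := by
    rintro (μ | μ)
    · exact h342_3_cube_inl b i c par hpar Rr H μ (e3' μ)
    · exact h342_3_cube_inr b i c par hpar Rr H μ (hasMajorant_geomT_of_toB6 i c Rr H (e3 μ))
  obtain ⟨hlaw1, hlaw2⟩ := DpK_mul_GpK b i c par hpar
  refine ⟨⟨hT1, hN1⟩, g342_1, g342_2, g342_3, ?_⟩
  exact H34 (shiftY i) (fun _ _ => (1 : 𝔸ˣ)) (g := geoCK i c) (Rr := Rr) (H := H) (blkCubeY i c) (kQCubeY i c par (fun _ _ => 1))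
    (sQCubeY i c par (fun _ _ => 1)) (cfunK i c) (wK i c) hdnn htri hrefl hsym (geoCK_len_pos i c) (geoCK_eta_le_len i c) (geoCK_eta_pos i c)
    (fun α hα hα1 => h261 i c Rr H hN1 α hα hα1.le) (hST_geoCK i c hδ₁ hT1)
    (fun _ _ => ⟨h1, by rw [inv_one, Units.val_one]; exact h1⟩) hd₀B hd₀F hd₀0 (wK_nonneg i c) (card_block_mul_wK_le i c)
    (fun y x hx => by rw [← hx]; exact norm_kQCubeY_one_le i c par h1 hpar _ x) (norm_sQCubeY_one_le i c par h1 hpar) (abs_cfunK_le i c)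
    hlaw1 hlaw2 g342_1 g342_2 g342_3

end Shared

/-! ## §3  ★★★ Everything at the cut field of the (3.35) datum: the cube-side package for `G′_□(Ṽ_□)` -/

section AtDatum

variable [NormOneClass 𝔸] [DecidableEq ι]

/-- ★★★ **COROLLARY 3.6 AT ONE COVER CUBE, THE CUBE-SIDE PACKAGE FOR `G′_□(Ṽ_□)`** — uniformly in the member and the cube: there are `δ₀, B_G > 0`, thresholds
`M₀, T₀, N₀`, Theorem 3.4's `a₁ > 0` and `B ≥ 0` (functions of `d, L`, the basis datum `M₂`) such that for every member above the thresholds, every cover cube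
`□`, every letter `Rr, H` of the target geometry and every (3.35) cube datum `(u, A)` on a torus set `Q ⊇ {within 4.375S_n + 1 of the centre}` with `U^u =
e^{iηA}` on the bonds of `Q`, `‖A‖ ≤ Cξ⁻¹`, `‖η⁻¹∂A‖ ≤ Cξ⁻²` there, a datum scale `0 < ξ ≤ 5S_nη` with `L^{n+1}η ≤ Λξ`, `1 ≤ Λ`, and the (3.37) size `α₁ :=
max C (C(1+D₁θ))·Λ² ≤ min(a₁, 1/4)`:
(i) `Δ′_{a,□}(Ṽ_□)` is a unit at `parSymY` and Theorem 3.4's extension IS the genuine letter, `GextK = GpVK = conj b(η²G′_□(Ṽ_□))`;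
(ii) the two located thresholds at the rate `δ₀` hold; (iii) the base entries `Gp ≺ B_G(Lⁿη)²e^{−δ₀d}`, `conj b(∇_k)·Gp`, `Gp·conj b(∇_k) ≺ B_GLⁿηe^{−δ₀d}`;
(iv) the (3.37) readings of `Ã = χ̃_□A` against the cube lengths — `‖Ã_k(x)‖, ‖Ã_k(x − e_ν)‖ ≤ α₁(L^{n(x)}η)⁻¹` — and the (3.59) sizes of `kF`, `sF` at `parSymY`;
(v) the two TRANSFER CLAUSES for `conj b(η²G′_□(Ṽ_□))`: every `X·Gp ≺ B_G·P·e^{−δ₀d}` (`P ≥ 0`) gives `X·conj b(η²G′_□(Ṽ_□)) ≺ B·P·e^{−(9/10)δ₀d}`, every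
`Gp·Y ≺ B_G·Lⁿη·e^{−δ₀d}` gives `conj b(η²G′_□(Ṽ_□))·Y ≺ B·Lⁿη·e^{−(9/10)δ₀d}`.
[cite: Balaban1985BackgroundPropagators, Cor. 3.6 p.408, Cor. 3.5 p.407, Thm 3.4 p.400, (3.64)–(3.65) p.402, p.409 l.1–5, Thm 3.1 (3.42) p.397, (3.35)–(3.37) p.396, (3.59)–(3.60) p.402] -/
theorem gp_cube_at_locCfg (d ℓ : ℕ) (hℓ : 1 ≤ ℓ) (M₂ : ℝ) (hM₂ : 0 ≤ M₂) (hrepr : ∀ (v : 𝔸) (j : ι), |b.repr v j| ≤ M₂ * ‖v‖) :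
    ∃ δ₀ BG M₀ T₀ : ℝ, ∃ N₀ : ℕ, 0 < δ₀ ∧ 0 < BG ∧ ∃ a₁ : ℝ, 0 < a₁ ∧ ∃ B : ℝ, 0 ≤ B ∧
    ∀ {hd : 1 ≤ d + 1} {hL : Odd (ℓ + 1) ∧ 1 < ℓ + 1} {b₀ b₁ : ℝ} (i : KIdx d ℓ hd hL b₀ b₁) (c : ↥(cubes (toKT i).D.toDomains)) (Rr : ℝ) (H : Prop),
      M₀ ≤ ((ℓ : ℝ) + 1) * (toKT i).Mh → N₀ + 1 ≤ (toKT i).R * ((ℓ + 1) * (toKT i).Mh) → T₀ ≤ RM1 i →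
    ∀ (g : GaugeY 𝔸 i) (U : CfgY 𝔸 i) (A : AfldY 𝔸 i) (Q : Set (Site (PV d ℓ i.m i.K hd hL) 0)) (C ξ Λ : ℝ),
      0 ≤ C → 0 < ξ → 1 ≤ Λ → ξ ≤ 5 * (SC i c : ℝ) * (kGeo i).eta → LatticeNorms.scaleLen ((ℓ : ℝ) + 1) (kGeo i).eta (c.1.1 + 1) ≤ Λ * ξ →
      (∀ x : Site (PV d ℓ i.m i.K hd hL) 0, NearC i c (35 * SC i c / 8 + 1) (boxEquiv i.hN x).1 → x ∈ Q) →
      (∀ (κ : Fin (d + 1)) (x : Site (PV d ℓ i.m i.K hd hL) 0), x ∈ Q → x.shift κ ∈ Q → gaugeY i g U κ x = fluct (kGeo i).eta A κ x) →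
      (∀ κ, ∀ x ∈ Q, ‖A κ x‖ ≤ C * ξ⁻¹) →
      (∀ μ ν, ∀ x ∈ Q, ‖(((kGeo i).eta : ℂ)⁻¹) • covD (shiftsV1 (PV d ℓ i.m i.K hd hL)) (fun _ _ => (1 : 𝔸ˣ)) μ (A ν) x‖ ≤ C * (ξ ^ 2)⁻¹) →
      max C (C * (1 + D1 thetaProf)) * Λ ^ 2 ≤ a₁ → max C (C * (1 + D1 thetaProf)) * Λ ^ 2 ≤ 1 / 4 →
      (IsUnit (deltaPrimeACubeY i c (parSymY i) (locCfgY i c (kGeo i).eta A)) ∧ GextK b i c (parSymY i) A = GpVK b i c (parSymY i) A) ∧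
      (4 * Real.log ((ℓ : ℝ) + 1) / (9 / 5000 * δ₀) ≤ RM1 i ∧ N1 d ℓ (9 / 5000 * δ₀) + 1 ≤ (toKT i).R * ((ℓ + 1) * (toKT i).Mh)) ∧
      (HasMajorant (g := toB6 (geoCK i c) Rr H) (fun p : SiteY i × ι => blkCubeY i c p.1) (GpK b i c (parSymY i))
          (fun a a' => BG * (geoCK i c).len a ^ 2 * Real.exp (-(δ₀ * (geoCK i c).dist a a'))) ∧
        (∀ k : Fin (d + 1) ⊕ Fin (d + 1), HasMajorant (g := toB6 (geoCK i c) Rr H) (fun p : SiteY i × ι => blkCubeY i c p.1)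
          (conj b (diffLetter (shiftY i) (fun _ _ => (1 : 𝔸ˣ)) ((((geoCK i c).eta : ℂ))⁻¹) k) * GpK b i c (parSymY i))
          (fun a a' => BG * (geoCK i c).len a * Real.exp (-(δ₀ * (geoCK i c).dist a a')))) ∧
        (∀ k : Fin (d + 1) ⊕ Fin (d + 1), HasMajorant (g := toB6 (geoCK i c) Rr H) (fun p : SiteY i × ι => blkCubeY i c p.1)
          (GpK b i c (parSymY i) * conj b (diffLetter (shiftY i) (fun _ _ => (1 : 𝔸ˣ)) ((((geoCK i c).eta : ℂ))⁻¹) k))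
          (fun a a' => BG * (geoCK i c).len a * Real.exp (-(δ₀ * (geoCK i c).dist a a'))))) ∧
      ((∀ k x, ‖chartA i (cutFldY i (chiTY i c) A) k x‖ ≤ max C (C * (1 + D1 thetaProf)) * Λ ^ 2 * ((geoCK i c).len (blkCubeY i c x))⁻¹) ∧
        (∀ ν k x, ‖tauB (shiftY i) (fun _ _ => (1 : 𝔸ˣ)) ν (chartA i (cutFldY i (chiTY i c) A) k) x‖ ≤
          max C (C * (1 + D1 thetaProf)) * Λ ^ 2 * ((geoCK i c).len (blkCubeY i c x))⁻¹) ∧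
        (∀ (y : BlkCubeY i c) (x : SiteY i), blkCubeY i c x = y →
          ‖kFCubeY i c (parSymY i) (fun _ _ => 1) (locCfgY i c (kGeo i).eta A) y x‖ ≤ Cq d * (max C (C * (1 + D1 thetaProf)) * Λ ^ 2) * wK i c y) ∧
        (∀ x : SiteY i, ‖sFCubeY i c (parSymY i) (fun _ _ => 1) (locCfgY i c (kGeo i).eta A) x‖ ≤ Cq d * (max C (C * (1 + D1 thetaProf)) * Λ ^ 2))) ∧
      (∀ (X : Module.End ℝ (SiteY i × ι → ℝ)) (P : BlkCubeY i c → ℝ), (∀ y, 0 ≤ P y) →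
        HasMajorant (g := toB6 (geoCK i c) Rr H) (fun p : SiteY i × ι => blkCubeY i c p.1) (X * GpK b i c (parSymY i))
          (fun a a' => BG * P a * Real.exp (-(δ₀ * (geoCK i c).dist a a'))) →
        HasMajorant (g := toB6 (geoCK i c) Rr H) (fun p : SiteY i × ι => blkCubeY i c p.1) (X * GpVK b i c (parSymY i) A)
          (fun a a' => B * P a * Real.exp (-(9 / 10 * δ₀ * (geoCK i c).dist a a')))) ∧
      (∀ Y : Module.End ℝ (SiteY i × ι → ℝ),
        HasMajorant (g := toB6 (geoCK i c) Rr H) (fun p : SiteY i × ι => blkCubeY i c p.1) (GpK b i c (parSymY i) * Y)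
          (fun a a' => BG * (geoCK i c).len a * Real.exp (-(δ₀ * (geoCK i c).dist a a'))) →
        HasMajorant (g := toB6 (geoCK i c) Rr H) (fun p : SiteY i × ι => blkCubeY i c p.1) (GpVK b i c (parSymY i) A * Y)
          (fun a a' => B * (geoCK i c).len a * Real.exp (-(9 / 10 * δ₀ * (geoCK i c).dist a a')))) := by
  have h1A : ‖(1 : 𝔸)‖ ≤ 1 := norm_one.le
  obtain ⟨δ₀, BG, M₀, T₀, N₀, hδ₀, hBG, a₁, ha₁, B, hB, Hmain⟩ := cor35_Gp_cube_shared b d ℓ hℓ (Cq d) M₂ (Cq_nonneg d) hM₂ hrepr h1A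
  refine ⟨δ₀, BG, M₀, T₀, N₀, hδ₀, hBG, a₁, ha₁, B, hB, ?_⟩
  intro hd hL b₀ b₁ i c Rr H hM hN hT g U A Q C ξ Λ hC hξ hΛ hξS hΛξ hQ hgA hA hdA hα₁ hα4
  set η : ℝ := (kGeo i).eta with hηdef
  have hη : 0 < η := by rw [hηdef, ← geoCK_eta i c]; exact geoCK_eta_pos i c
  set α₁ : ℝ := max C (C * (1 + D1 thetaProf)) * Λ ^ 2 with hα₁def
  have hα₁0 : 0 ≤ α₁ := by
    rw [hα₁def]; exact mul_nonneg (le_max_of_le_left hC) (sq_nonneg _)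
  -- the length function of the engine at the cube blocks is `L^{n(z)}η`
  have hL1 : (1 : ℝ) ≤ (ℓ : ℝ) + 1 := by linarith [(Nat.cast_nonneg ℓ : (0 : ℝ) ≤ ℓ)]
  have hlenS : ∀ z : SiteY i, (geoCK i c).len (blkCubeY i c z) = LatticeNorms.scaleLen ((ℓ : ℝ) + 1) η (levCubeY i c z) := fun z => by
    rw [(geoCK_len_blkCubeY i c z).1]; rfl
  have hlen : ∀ z : SiteY i, 0 < (geoCK i c).len (blkCubeY i c z) := fun z => by
    rw [hlenS]; exact (scaleLen_levCubeY_bounds i c hL1 hη hΛξ z).1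
  have hlenΛ : ∀ z : SiteY i, (geoCK i c).len (blkCubeY i c z) ≤ Λ * ξ := fun z => by
    rw [hlenS]; exact (scaleLen_levCubeY_bounds i c hL1 hη hΛξ z).2
  -- the five (3.37) readings of the cut field (FILE 4)
  obtain ⟨r1, r2, r3, r4, r5⟩ := readings337_locFld i c hC hη hξ hΛ hξS hQ hA hdA (fun z => (geoCK i c).len (blkCubeY i c z)) hlen hlenΛ
  -- the (3.59) kernel sizes (FILE 7a-prep, currency A at the base `1`, `G := ⊥`)
  have hG1 : ∀ u : 𝔸ˣ, u ∈ (⊥ : Subgroup 𝔸ˣ) → ‖(u : 𝔸)‖ ≤ 1 := fun u hu => by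
    rw [Subgroup.mem_bot] at hu; rw [hu, Units.val_one]; exact h1A
  have hU1 : ∀ (μ : Fin (d + 1)) (x : Site (PV d ℓ i.m i.K hd hL) 0), ((fun _ _ => (1 : 𝔸ˣ)) : CfgY 𝔸 i) μ x ∈ (⊥ : Subgroup 𝔸ˣ) :=
    fun _ _ => Subgroup.one_mem _
  have hown := ownLevel_of_blockwise i c hη (cutFldY i (chiTY i c) A) (α₁ := α₁) (fun k x => by
    have h := r4 k x
    rw [(geoCK_len_blkCubeY i c x).1, levCubeY_eq] at h
    push_cast
    exact h)
  have hkF : ∀ (y : BlkCubeY i c) (x : SiteY i), blkCubeY i c x = y →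
      ‖kFCubeY i c (parSymY i) (fun _ _ => 1) (locCfgY i c η A) y x‖ ≤ Cq d * α₁ * wK i c y :=
    fun y x hx => norm_kFCubeY_parSymY_le i c ⊥ hG1 hU1 hη.le (cutFldY i (chiTY i c) A) y hα₁0 hα4 (hown y) x hx
  have hsF : ∀ x : SiteY i, ‖sFCubeY i c (parSymY i) (fun _ _ => 1) (locCfgY i c η A) x‖ ≤ Cq d * α₁ :=
    fun x => norm_sFCubeY_parSymY_le i c ⊥ hG1 hU1 hη.le (cutFldY i (chiTY i c) A) x hα₁0 hα4 (hown (blkCubeY i c x))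
  -- Theorem 3.4 at the cube (§2): the two-sided inverse and the transfer clauses
  have hparone : ∀ z w : SiteY i, parSymY i (fun _ _ => (1 : 𝔸ˣ)) z w = 1 := fun z w => parSymY_one i z w
  obtain ⟨hthr, hbase, hL34, hR34, Heng⟩ := Hmain i c Rr H (parSymY i) hparone hM hN hT
  obtain ⟨l1, l2, l3, l4⟩ := Heng α₁ hα₁0 hα₁ (chartA i (cutFldY i (chiTY i c) A))
    (kFCubeY i c (parSymY i) (fun _ _ => 1) (locCfgY i c η A)) (sFCubeY i c (parSymY i) (fun _ _ => 1) (locCfgY i c η A)) hkF hsF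
    (fun ν k x => by rw [geoCK_eta]; exact r1 ν k x) (fun μ ν x => by rw [geoCK_eta]; exact r2 μ ν x)
    (fun μ x => by rw [geoCK_eta]; exact r3 μ x) r4 r5
  -- (i): the unit and the identification
  have hid := GextK_eq_GpVK b i c (parSymY i) A l1 l2
  refine ⟨hid, hthr, ⟨hbase, hL34, hR34⟩, ⟨r4, r5, hkF, hsF⟩, fun X P hP hX => ?_, fun Y hY => ?_⟩
  · have h := l3 X P hP hX
    change HasMajorant (g := toB6 (geoCK i c) Rr H) (fun p : SiteY i × ι => blkCubeY i c p.1) (X * GextK b i c (parSymY i) A) _ at h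
    rwa [hid.2] at h
  · have h := l4 Y hY
    change HasMajorant (g := toB6 (geoCK i c) Rr H) (fun p : SiteY i × ι => blkCubeY i c p.1) (GextK b i c (parSymY i) A * Y) _ at h
    rwa [hid.2] at h

omit [NormOneClass 𝔸] [DecidableEq ι] in
/-- ★ **(3.42)₁ FOR `G′_□(Ṽ_□)` OVER THE CUBE SEQUENCE's BLOCKS** (the transfer clause at `X := 1`, `P := (Lⁿη)²`): `conj b(η²G′_□(Ṽ_□)) ≺ B·(Lⁿη)²·e^{−(9/10)δ₀d}`.
[cite: Balaban1985BackgroundPropagators, Cor. 3.6 p.408, Thm 3.1 (3.42)₁ p.397, p.409 l.1–5, Thm 3.4 p.400] -/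
theorem hasMajorant_GpVK (i : KIdx d ℓ hd hL b₀ b₁) (c : ↥(cubes (toKT i).D.toDomains)) (Rr : ℝ) (H : Prop) (A : AfldY 𝔸 i) {BG B δ₀ : ℝ}
    (hbase : HasMajorant (g := toB6 (geoCK i c) Rr H) (fun p : SiteY i × ι => blkCubeY i c p.1) (GpK b i c (parSymY i))
      (fun a a' => BG * (geoCK i c).len a ^ 2 * Real.exp (-(δ₀ * (geoCK i c).dist a a'))))
    (hX : ∀ (X : Module.End ℝ (SiteY i × ι → ℝ)) (P : BlkCubeY i c → ℝ), (∀ y, 0 ≤ P y) →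
      HasMajorant (g := toB6 (geoCK i c) Rr H) (fun p : SiteY i × ι => blkCubeY i c p.1) (X * GpK b i c (parSymY i))
        (fun a a' => BG * P a * Real.exp (-(δ₀ * (geoCK i c).dist a a'))) →
      HasMajorant (g := toB6 (geoCK i c) Rr H) (fun p : SiteY i × ι => blkCubeY i c p.1) (X * GpVK b i c (parSymY i) A)
        (fun a a' => B * P a * Real.exp (-(9 / 10 * δ₀ * (geoCK i c).dist a a')))) :
    HasMajorant (g := toB6 (geoCK i c) Rr H) (fun p : SiteY i × ι => blkCubeY i c p.1) (GpVK b i c (parSymY i) A)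
      (fun a a' => B * (geoCK i c).len a ^ 2 * Real.exp (-(9 / 10 * δ₀ * (geoCK i c).dist a a'))) := by
  have h := hX 1 (fun a => (geoCK i c).len a ^ 2) (fun a => sq_nonneg _) (by rw [one_mul]; exact hbase)
  rwa [one_mul] at h

end AtDatum

end Literature.MathematicalPhysics.QuantumFieldTheory.Balaban1983to89.B9Cor36GpCubeExtAtV

end
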